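import Mathlib
import Literature.Probability.LatticeModels.ThermodynamicLimit

/-!
# Bounded mixed germ from uniform moments — for stub `stub_treeDecayBoundsGerm` of line
`lee-yang-mass-handover`
(crux `Summit.QuantumFields.QCD.Theses.HeatSlicedQuarks.RobustYangMillsHandover`,
item stmt-QuantumFields-8892; serves item stmt-QuantumFields-16261
`AnomalyRigidity.TreeDecayBoundsGerm`)

`treeGerm_germ_bound_of_moments`: if the weighted lattice transforms
`Φ_{k,S}(p,q) = a_k⁸ ∑_{x,y ∈ box 4 S} e^{i(p·ξ+q·η)} w_k G_k(S;x,y)` converge pointwise to `Γ`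
(eventually in `k`, for `S ≥ L_k`) and the global weighted moments
`∑∑ a_k⁸ ‖ξ‖^i ‖η‖^j ‖w_k G‖`, `i, j ∈ {1,2}`, are eventually `≤ Mb`, then
`Γ(p,q) − Γ(p,0) − Γ(0,q) + Γ(0,0) = ∑ B_{αβ} p_α q_β + o(‖(p,q)‖²)` with `‖B_{αβ}‖ ≤ Mb`.
Ingredients: the Taylor bound `‖(e^{is} − 1)(e^{it} − 1) + st‖ ≤ 3(s²|t| + |s|t²)`
(`treeGerm_norm_expProd_add_mul_le`), the algebraic identity for the mixed second difference of a
lattice Fourier transform (`treeGerm_mixed_difference_identity`), Bolzano–Weierstrass for the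
second mixed moments (`treeGerm_exists_subseq_of_eventually_norm_le`), and the cubic remainder
bound, which is `o(‖(p,q)‖²)`.

Pure Mathlib analysis (plus `Literature.Probability.LatticeModels.box`).
-/

namespace Summit.QuantumFields.QCD.Cruxes.RobustYangMillsHandover.LeeYangMassHandover

open Filter Topology Asymptotics Finset Literature.Probability.LatticeModels

/-- `‖e^{is} - 1 - is‖ ≤ 3 s²` for real `s`. [folklore] -/
theorem treeGerm_norm_cexp_sub_one_sub_le (s : ℝ) :
    ‖Complex.exp (Complex.I * s) - 1 - Complex.I * s‖ ≤ 3 * s ^ 2 := by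
  have hn : ‖Complex.I * (s : ℂ)‖ = |s| := by simp
  rcases le_or_gt |s| 1 with h | h
  · calc ‖Complex.exp (Complex.I * s) - 1 - Complex.I * s‖ ≤ ‖Complex.I * (s : ℂ)‖ ^ 2 :=
          Complex.norm_exp_sub_one_sub_id_le (by rw [hn]; exact h)
      _ = s ^ 2 := by rw [hn, sq_abs]
      _ ≤ 3 * s ^ 2 := by nlinarith [sq_nonneg s]
  · calc ‖Complex.exp (Complex.I * s) - 1 - Complex.I * s‖
        ≤ ‖Complex.exp (Complex.I * s)‖ + ‖(1 : ℂ)‖ + ‖Complex.I * (s : ℂ)‖ :=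
          norm_sub_le_of_le (norm_sub_le _ _) le_rfl
      _ = 2 + |s| := by
          rw [hn, Complex.norm_exp_I_mul_ofReal, norm_one]; ring
      _ ≤ 3 * s ^ 2 := by nlinarith [sq_abs s]

/-- `‖(e^{is} - 1)(e^{it} - 1) + st‖ ≤ 3 (s²|t| + |s|t²)` for real `s, t`. [folklore] -/
theorem treeGerm_norm_expProd_add_mul_le (s t : ℝ) :
    ‖(Complex.exp (Complex.I * s) - 1) * (Complex.exp (Complex.I * t) - 1) + ((s * t : ℝ) : ℂ)‖
      ≤ 3 * (s ^ 2 * |t| + |s| * t ^ 2) := by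
  have h1 := treeGerm_norm_cexp_sub_one_sub_le s
  have h2 := treeGerm_norm_cexp_sub_one_sub_le t
  have h3 : ‖Complex.exp (Complex.I * t) - 1‖ ≤ |t| := by
    simpa using (Real.norm_exp_I_mul_ofReal_sub_one_le (x := t))
  have hid : (Complex.exp (Complex.I * s) - 1) * (Complex.exp (Complex.I * t) - 1) +
        ((s * t : ℝ) : ℂ)
      = (Complex.exp (Complex.I * s) - 1 - Complex.I * s) * (Complex.exp (Complex.I * t) - 1)
        + Complex.I * s * (Complex.exp (Complex.I * t) - 1 - Complex.I * t) := by
    push_cast; ring_nf; rw [Complex.I_sq]; ring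
  rw [hid]
  refine (norm_add_le _ _).trans ?_
  rw [norm_mul, norm_mul]
  have hIs : ‖Complex.I * (s : ℂ)‖ = |s| := by simp
  rw [hIs]
  have := mul_le_mul h1 h3 (norm_nonneg _) (by positivity)
  have := mul_le_mul_of_nonneg_left h2 (abs_nonneg s)
  nlinarith

/-- `|∑ᵢ pᵢ ξᵢ| ≤ 4 ‖p‖ ‖ξ‖` in the sup norm on `Fin 4 → ℝ`. [folklore] -/
theorem treeGerm_abs_dot_le (p ξ : Fin 4 → ℝ) : |∑ i, p i * ξ i| ≤ 4 * ‖p‖ * ‖ξ‖ := by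
  calc |∑ i, p i * ξ i| ≤ ∑ i, |p i * ξ i| := Finset.abs_sum_le_sum_abs _ _
    _ ≤ ∑ _i : Fin 4, ‖p‖ * ‖ξ‖ := by
        refine Finset.sum_le_sum fun i _ => ?_
        rw [abs_mul, ← Real.norm_eq_abs, ← Real.norm_eq_abs]
        exact mul_le_mul (norm_le_pi_norm p i) (norm_le_pi_norm ξ i) (norm_nonneg _) (norm_nonneg _)
    _ = 4 * ‖p‖ * ‖ξ‖ := by simp [Finset.sum_const, Finset.card_univ, Fintype.card_fin]; ring

/-- Bolzano–Weierstrass for an eventually bounded sequence in a proper normed group. [folklore] -/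
theorem treeGerm_exists_subseq_of_eventually_norm_le {E : Type*} [NormedAddCommGroup E]
    [ProperSpace E]
    (u : ℕ → E) (R : ℝ) (h : ∀ᶠ n in atTop, ‖u n‖ ≤ R) :
    ∃ b : E, ‖b‖ ≤ R ∧ ∃ φ : ℕ → ℕ, StrictMono φ ∧ Tendsto (u ∘ φ) atTop (𝓝 b) := by
  have hfr : ∃ᶠ n in atTop, u n ∈ Metric.closedBall (0 : E) R :=
    (h.mono fun n hn => mem_closedBall_zero_iff.mpr hn).frequently
  obtain ⟨b, hb, φ, hφ, hlim⟩ :=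
    tendsto_subseq_of_frequently_bounded (Metric.isBounded_closedBall (x := (0 : E)) (r := R)) hfr
  rw [Metric.isClosed_closedBall.closure_eq, mem_closedBall_zero_iff] at hb
  exact ⟨b, hb, φ, hφ, hlim⟩

/-- Swapping a pair of summations past another pair. [folklore] -/
theorem treeGerm_sum4_comm {ι κ α β M : Type*} [AddCommMonoid M] (A : Finset ι) (B : Finset κ)
    (s : Finset α) (t : Finset β) (f : ι → κ → α → β → M) :
    ∑ i ∈ A, ∑ k ∈ B, ∑ x ∈ s, ∑ y ∈ t, f i k x y
      = ∑ x ∈ s, ∑ y ∈ t, ∑ i ∈ A, ∑ k ∈ B, f i k x y := by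
  calc ∑ i ∈ A, ∑ k ∈ B, ∑ x ∈ s, ∑ y ∈ t, f i k x y
      = ∑ i ∈ A, ∑ x ∈ s, ∑ k ∈ B, ∑ y ∈ t, f i k x y :=
        Finset.sum_congr rfl fun i _ => Finset.sum_comm
    _ = ∑ x ∈ s, ∑ i ∈ A, ∑ k ∈ B, ∑ y ∈ t, f i k x y := Finset.sum_comm
    _ = ∑ x ∈ s, ∑ i ∈ A, ∑ y ∈ t, ∑ k ∈ B, f i k x y :=
        Finset.sum_congr rfl fun x _ => Finset.sum_congr rfl fun i _ => Finset.sum_comm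
    _ = ∑ x ∈ s, ∑ y ∈ t, ∑ i ∈ A, ∑ k ∈ B, f i k x y :=
        Finset.sum_congr rfl fun x _ => Finset.sum_comm

/-- **The mixed second difference of a weighted lattice Fourier transform.**  With phases
`s = p·u(x)`, `t = q·v(y)`:  `Φ(p,q) − Φ(p,0) − Φ(0,q) + Φ(0,0) − ∑ B_{αβ} p_α q_β
= c ∑∑ ((e^{is} − 1)(e^{it} − 1) + s t) w K`, where `B_{αβ} = −c ∑∑ u_α v_β w K`. [folklore] -/
theorem treeGerm_mixed_difference_identity {α β : Type*} (s : Finset α) (t : Finset β) (c w : ℂ)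
    (K : α → β → ℂ) (u : α → Fin 4 → ℝ) (v : β → Fin 4 → ℝ) (p q : Fin 4 → ℝ) :
    c * ∑ x ∈ s, ∑ y ∈ t, Complex.exp (Complex.I *
        ((∑ i, (p i * u x i + q i * v y i) : ℝ) : ℂ)) * w * K x y
    - c * ∑ x ∈ s, ∑ y ∈ t, Complex.exp (Complex.I *
        ((∑ i, (p i * u x i + (0 : Fin 4 → ℝ) i * v y i) : ℝ) : ℂ)) * w * K x y
    - c * ∑ x ∈ s, ∑ y ∈ t, Complex.exp (Complex.I *
        ((∑ i, ((0 : Fin 4 → ℝ) i * u x i + q i * v y i) : ℝ) : ℂ)) * w * K x y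
    + c * ∑ x ∈ s, ∑ y ∈ t, Complex.exp (Complex.I *
        ((∑ i, ((0 : Fin 4 → ℝ) i * u x i + (0 : Fin 4 → ℝ) i * v y i) : ℝ) : ℂ)) * w * K x y
    - ∑ al, ∑ be, -(c * ∑ x ∈ s, ∑ y ∈ t,
        ((u x al : ℝ) : ℂ) * ((v y be : ℝ) : ℂ) * w * K x y) * ((p al : ℝ) : ℂ) * ((q be : ℝ) : ℂ)
    = c * ∑ x ∈ s, ∑ y ∈ t,
        ((Complex.exp (Complex.I * ((∑ i, p i * u x i : ℝ) : ℂ)) - 1) *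
            (Complex.exp (Complex.I * ((∑ i, q i * v y i : ℝ) : ℂ)) - 1) +
          (((∑ i, p i * u x i) * (∑ i, q i * v y i) : ℝ) : ℂ)) * w * K x y := by
  -- the bilinear term
  have hbl : ∑ al, ∑ be, -(c * ∑ x ∈ s, ∑ y ∈ t,
        ((u x al : ℝ) : ℂ) * ((v y be : ℝ) : ℂ) * w * K x y) * ((p al : ℝ) : ℂ) * ((q be : ℝ) : ℂ)
      = -(c * ∑ x ∈ s, ∑ y ∈ t,
          (((∑ i, p i * u x i : ℝ) : ℂ) * ((∑ i, q i * v y i : ℝ) : ℂ)) * w * K x y) := by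
    push_cast
    simp only [Finset.sum_mul_sum]
    simp only [neg_mul, Finset.sum_neg_distrib, Finset.mul_sum, Finset.sum_mul]
    congr 1
    rw [treeGerm_sum4_comm]
    refine Finset.sum_congr rfl fun x _ => Finset.sum_congr rfl fun y _ =>
      Finset.sum_congr rfl fun al _ => Finset.sum_congr rfl fun be _ => ?_
    ring
  rw [hbl]
  -- the four phases
  have hph1 : ∀ (x : α) (y : β),
      Complex.exp (Complex.I * ((∑ i, (p i * u x i + q i * v y i) : ℝ) : ℂ))
      = Complex.exp (Complex.I * ((∑ i, p i * u x i : ℝ) : ℂ)) *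
          Complex.exp (Complex.I * ((∑ i, q i * v y i : ℝ) : ℂ)) := by
    intro x y
    rw [← Complex.exp_add, Finset.sum_add_distrib]
    congr 1
    push_cast
    ring
  have hph2 : ∀ (x : α) (y : β),
      Complex.exp (Complex.I * ((∑ i, (p i * u x i + (0 : Fin 4 → ℝ) i * v y i) : ℝ) : ℂ))
        = Complex.exp (Complex.I * ((∑ i, p i * u x i : ℝ) : ℂ)) := by
    intro x y; simp only [Pi.zero_apply, zero_mul, add_zero]
  have hph3 : ∀ (x : α) (y : β),
      Complex.exp (Complex.I * ((∑ i, ((0 : Fin 4 → ℝ) i * u x i + q i * v y i) : ℝ) : ℂ))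
        = Complex.exp (Complex.I * ((∑ i, q i * v y i : ℝ) : ℂ)) := by
    intro x y; simp only [Pi.zero_apply, zero_mul, zero_add]
  have hph4 : ∀ (x : α) (y : β), Complex.exp (Complex.I *
      ((∑ i, ((0 : Fin 4 → ℝ) i * u x i + (0 : Fin 4 → ℝ) i * v y i) : ℝ) : ℂ)) = 1 := by
    intro x y; simp
  simp only [hph1, hph2, hph3, hph4]
  -- combine into one double sum
  rw [sub_neg_eq_add, ← mul_sub, ← mul_sub, ← mul_add, ← mul_add]
  congr 1
  simp only [← Finset.sum_sub_distrib, ← Finset.sum_add_distrib]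
  refine Finset.sum_congr rfl fun x _ => Finset.sum_congr rfl fun y _ => ?_
  push_cast
  ring

/-- **Bounded mixed germ from uniform second moments** (the analytic core of item 16261).
If the weighted lattice transforms `Φ_{k,S}(p,q) = a_k⁸ ∑∑ e^{i(p·ξ+q·η)} w_k G` converge
pointwise to `Γ` (eventually in `k`, for `S ≥ L_k`) and the global weighted moments with weights
`‖ξ‖^i ‖η‖^j`, `i, j ∈ {1,2}`, are eventually bounded by `Mb`, then the mixed second difference of
`Γ` at `0` is a bilinear form with coefficients of norm `≤ Mb`, up to `o(‖(p,q)‖²)`: Taylor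
expansion of `(e^{is}−1)(e^{it}−1)` to order `s t`, Bolzano–Weierstrass for the second mixed
moments, and the cubic remainder bound. [folklore] -/
theorem treeGerm_germ_bound_of_moments :
    ∀ (a : ℕ → ℝ) (L : ℕ → ℕ) (ph : ℕ → (Fin 4 → ℤ) → Fin 4 → ℝ) (w : ℕ → ℂ) (G : ℕ → ℕ → (Fin 4 →
    ℤ) → (Fin 4 → ℤ) → ℂ) (Γ : (Fin 4 → ℝ) → (Fin 4 → ℝ) → ℂ) (Mb : ℝ), (∀ (p q : Fin 4 → ℝ) (δ :
    ℝ), 0 < δ → ∀ᶠ k in Filter.atTop, ∀ S : ℕ, L k ≤ S → ‖((a k ^ 8 : ℝ) : ℂ) * ∑ x ∈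
    Literature.Probability.LatticeModels.box 4 S, ∑ y ∈ Literature.Probability.LatticeModels.box 4
    S, Complex.exp (Complex.I * ((∑ i : Fin 4, (p i * ph k x i + q i * ph k y i) : ℝ) : ℂ)) * w k
    * G k S x y - Γ p q‖ ≤ δ) → (∀ i j : ℕ, 1 ≤ i → i ≤ 2 → 1 ≤ j → j ≤ 2 → ∀ᶠ k in Filter.atTop,
    ∀ S : ℕ, L k ≤ S → ∑ x ∈ Literature.Probability.LatticeModels.box 4 S, ∑ y ∈
    Literature.Probability.LatticeModels.box 4 S, a k ^ 8 * ‖ph k x‖ ^ i * ‖ph k y‖ ^ j * ‖w k * G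
    k S x y‖ ≤ Mb) → ∃ B : Fin 4 → Fin 4 → ℂ, (∀ al be, ‖B al be‖ ≤ Mb) ∧ (fun k : (Fin 4 → ℝ) ×
    (Fin 4 → ℝ) => Γ k.1 k.2 - Γ k.1 0 - Γ 0 k.2 + Γ 0 0 - ∑ al : Fin 4, ∑ be : Fin 4, B al be *
    ((k.1 al : ℝ) : ℂ) * ((k.2 be : ℝ) : ℂ)) =o[nhds 0] (fun k : (Fin 4 → ℝ) × (Fin 4 → ℝ) => ‖k‖
    ^ 2) := by
  intro a L ph w G Γ Mb hconv hmom
  -- the transforms at `S = L k` and their second mixed moments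
  set Φ : ℕ → (Fin 4 → ℝ) → (Fin 4 → ℝ) → ℂ := fun k p q =>
    ((a k ^ 8 : ℝ) : ℂ) * ∑ x ∈ box 4 (L k), ∑ y ∈ box 4 (L k),
      Complex.exp (Complex.I * ((∑ i : Fin 4, (p i * ph k x i + q i * ph k y i) : ℝ) : ℂ)) *
        w k * G k (L k) x y with hΦ
  set Bk : ℕ → Fin 4 → Fin 4 → ℂ := fun k al be =>
    -(((a k ^ 8 : ℝ) : ℂ) * ∑ x ∈ box 4 (L k), ∑ y ∈ box 4 (L k),
      ((ph k x al : ℝ) : ℂ) * ((ph k y be : ℝ) : ℂ) * w k * G k (L k) x y) with hBk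
  have ha8 : ∀ k, ‖((a k ^ 8 : ℝ) : ℂ)‖ = a k ^ 8 := fun k => by
    rw [Complex.norm_real, Real.norm_of_nonneg (by positivity)]
  -- Step 1: the second mixed moments are eventually bounded by `Mb`
  have hB1 : ∀ᶠ k in atTop, ‖Bk k‖ ≤ Mb := by
    filter_upwards [hmom 1 1 le_rfl (by norm_num) le_rfl (by norm_num)] with k hk
    have hk := hk (L k) le_rfl
    have hMb : 0 ≤ Mb :=
      le_trans (Finset.sum_nonneg fun x _ => Finset.sum_nonneg fun y _ => by positivity) hk
    refine (pi_norm_le_iff_of_nonneg hMb).mpr fun al =>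
      (pi_norm_le_iff_of_nonneg hMb).mpr fun be => ?_
    calc ‖Bk k al be‖
        ≤ a k ^ 8 * ∑ x ∈ box 4 (L k), ∑ y ∈ box 4 (L k),
            ‖((ph k x al : ℝ) : ℂ) * ((ph k y be : ℝ) : ℂ) * w k * G k (L k) x y‖ := by
          rw [show Bk k al be = -(((a k ^ 8 : ℝ) : ℂ) * ∑ x ∈ box 4 (L k), ∑ y ∈ box 4 (L k),
            ((ph k x al : ℝ) : ℂ) * ((ph k y be : ℝ) : ℂ) * w k * G k (L k) x y) from rfl,
            norm_neg, norm_mul, ha8]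
          exact mul_le_mul_of_nonneg_left ((norm_sum_le _ _).trans
            (Finset.sum_le_sum fun x _ => norm_sum_le _ _)) (by positivity)
      _ ≤ ∑ x ∈ box 4 (L k), ∑ y ∈ box 4 (L k),
            a k ^ 8 * ‖ph k x‖ ^ 1 * ‖ph k y‖ ^ 1 * ‖w k * G k (L k) x y‖ := by
          rw [Finset.mul_sum]
          refine Finset.sum_le_sum fun x _ => ?_
          rw [Finset.mul_sum]
          refine Finset.sum_le_sum fun y _ => ?_
          have h1 : ‖((ph k x al : ℝ) : ℂ)‖ ≤ ‖ph k x‖ := by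
            rw [Complex.norm_real]; exact norm_le_pi_norm _ al
          have h2 : ‖((ph k y be : ℝ) : ℂ)‖ ≤ ‖ph k y‖ := by
            rw [Complex.norm_real]; exact norm_le_pi_norm _ be
          rw [mul_assoc _ (w k), norm_mul, norm_mul, pow_one, pow_one]
          calc a k ^ 8 * (‖((ph k x al : ℝ) : ℂ)‖ * ‖((ph k y be : ℝ) : ℂ)‖ * ‖w k * G k (L k) x y‖)
              ≤ a k ^ 8 * (‖ph k x‖ * ‖ph k y‖ * ‖w k * G k (L k) x y‖) := by gcongr
            _ = _ := by ring
      _ ≤ Mb := hk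
  -- Step 2: Bolzano–Weierstrass
  obtain ⟨B, hBn, φs, hφs, hlim⟩ := treeGerm_exists_subseq_of_eventually_norm_le Bk Mb hB1
  refine ⟨B, fun al be => (norm_le_pi_norm (B al) be).trans ((norm_le_pi_norm B al).trans hBn), ?_⟩
  -- Step 3: the cubic Taylor remainder, uniformly in k (eventually)
  have hR : ∀ᶠ k in atTop, ∀ p q : Fin 4 → ℝ,
      ‖Φ k p q - Φ k p 0 - Φ k 0 q + Φ k 0 0 -
          ∑ al, ∑ be, Bk k al be * ((p al : ℝ) : ℂ) * ((q be : ℝ) : ℂ)‖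
        ≤ 192 * Mb * (‖p‖ ^ 2 * ‖q‖ + ‖p‖ * ‖q‖ ^ 2) := by
    filter_upwards [hmom 2 1 (by norm_num) le_rfl le_rfl (by norm_num),
      hmom 1 2 le_rfl (by norm_num) (by norm_num) le_rfl] with k h21 h12 p q
    have h21 := h21 (L k) le_rfl
    have h12 := h12 (L k) le_rfl
    have hid := treeGerm_mixed_difference_identity (box 4 (L k)) (box 4 (L k))
      ((a k ^ 8 : ℝ) : ℂ) (w k) (G k (L k)) (ph k) (ph k) p q
    simp only [hΦ, hBk]
    rw [hid, norm_mul, ha8]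
    -- pointwise bound on the remainder
    have hpt : ∀ x y : Fin 4 → ℤ,
        ‖((Complex.exp (Complex.I * ((∑ i, p i * ph k x i : ℝ) : ℂ)) - 1) *
            (Complex.exp (Complex.I * ((∑ i, q i * ph k y i : ℝ) : ℂ)) - 1) +
            (((∑ i, p i * ph k x i) * (∑ i, q i * ph k y i) : ℝ) : ℂ)) * w k * G k (L k) x y‖
          ≤ (192 * (‖p‖ ^ 2 * ‖q‖) * (‖ph k x‖ ^ 2 * ‖ph k y‖ ^ 1) +
              192 * (‖p‖ * ‖q‖ ^ 2) * (‖ph k x‖ ^ 1 * ‖ph k y‖ ^ 2)) * ‖w k * G k (L k) x y‖ := by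
      intro x y
      rw [mul_assoc _ (w k), norm_mul]
      refine mul_le_mul_of_nonneg_right ?_ (norm_nonneg _)
      have hs := treeGerm_abs_dot_le p (ph k x)
      have ht := treeGerm_abs_dot_le q (ph k y)
      refine (treeGerm_norm_expProd_add_mul_le _ _).trans ?_
      have hs2 : (∑ i, p i * ph k x i) ^ 2 ≤ (4 * ‖p‖ * ‖ph k x‖) ^ 2 := by
        rw [← sq_abs]; exact pow_le_pow_left₀ (abs_nonneg _) hs 2
      have ht2 : (∑ i, q i * ph k y i) ^ 2 ≤ (4 * ‖q‖ * ‖ph k y‖) ^ 2 := by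
        rw [← sq_abs]; exact pow_le_pow_left₀ (abs_nonneg _) ht 2
      have h1 : (∑ i, p i * ph k x i) ^ 2 * |∑ i, q i * ph k y i|
          ≤ (4 * ‖p‖ * ‖ph k x‖) ^ 2 * (4 * ‖q‖ * ‖ph k y‖) :=
        mul_le_mul hs2 ht (abs_nonneg _) (by positivity)
      have h2 : |∑ i, p i * ph k x i| * (∑ i, q i * ph k y i) ^ 2
          ≤ (4 * ‖p‖ * ‖ph k x‖) * (4 * ‖q‖ * ‖ph k y‖) ^ 2 :=
        mul_le_mul hs ht2 (by positivity) (by positivity)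
      calc 3 * ((∑ i, p i * ph k x i) ^ 2 * |∑ i, q i * ph k y i| +
              |∑ i, p i * ph k x i| * (∑ i, q i * ph k y i) ^ 2)
          ≤ 3 * ((4 * ‖p‖ * ‖ph k x‖) ^ 2 * (4 * ‖q‖ * ‖ph k y‖) +
              (4 * ‖p‖ * ‖ph k x‖) * (4 * ‖q‖ * ‖ph k y‖) ^ 2) := by linarith
        _ = _ := by ring
    calc a k ^ 8 * ‖∑ x ∈ box 4 (L k), ∑ y ∈ box 4 (L k),
          ((Complex.exp (Complex.I * ((∑ i, p i * ph k x i : ℝ) : ℂ)) - 1) *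
            (Complex.exp (Complex.I * ((∑ i, q i * ph k y i : ℝ) : ℂ)) - 1) +
            (((∑ i, p i * ph k x i) * (∑ i, q i * ph k y i) : ℝ) : ℂ)) * w k * G k (L k) x y‖
        ≤ a k ^ 8 * ∑ x ∈ box 4 (L k), ∑ y ∈ box 4 (L k),
            (192 * (‖p‖ ^ 2 * ‖q‖) * (‖ph k x‖ ^ 2 * ‖ph k y‖ ^ 1) +
              192 * (‖p‖ * ‖q‖ ^ 2) * (‖ph k x‖ ^ 1 * ‖ph k y‖ ^ 2)) * ‖w k * G k (L k) x y‖ := by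
          refine mul_le_mul_of_nonneg_left ((norm_sum_le _ _).trans
            (Finset.sum_le_sum fun x _ => (norm_sum_le _ _).trans
              (Finset.sum_le_sum fun y _ => hpt x y))) (by positivity)
      _ = 192 * (‖p‖ ^ 2 * ‖q‖) * ∑ x ∈ box 4 (L k), ∑ y ∈ box 4 (L k),
              a k ^ 8 * ‖ph k x‖ ^ 2 * ‖ph k y‖ ^ 1 * ‖w k * G k (L k) x y‖
          + 192 * (‖p‖ * ‖q‖ ^ 2) * ∑ x ∈ box 4 (L k), ∑ y ∈ box 4 (L k),
              a k ^ 8 * ‖ph k x‖ ^ 1 * ‖ph k y‖ ^ 2 * ‖w k * G k (L k) x y‖ := by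
          rw [Finset.mul_sum, Finset.mul_sum, Finset.mul_sum, ← Finset.sum_add_distrib]
          refine Finset.sum_congr rfl fun x _ => ?_
          rw [Finset.mul_sum, Finset.mul_sum, Finset.mul_sum, ← Finset.sum_add_distrib]
          refine Finset.sum_congr rfl fun y _ => ?_
          ring
      _ ≤ 192 * (‖p‖ ^ 2 * ‖q‖) * Mb + 192 * (‖p‖ * ‖q‖ ^ 2) * Mb :=
          add_le_add (mul_le_mul_of_nonneg_left h21 (by positivity))
            (mul_le_mul_of_nonneg_left h12 (by positivity))
      _ = 192 * Mb * (‖p‖ ^ 2 * ‖q‖ + ‖p‖ * ‖q‖ ^ 2) := by ring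
  -- Step 4: pass to the limit along the subsequence
  have hMb0 : 0 ≤ Mb := (norm_nonneg _).trans hBn
  have hφt : Tendsto φs atTop atTop := hφs.tendsto_atTop
  have hpt : ∀ p q : Fin 4 → ℝ,
      ‖Γ p q - Γ p 0 - Γ 0 q + Γ 0 0 - ∑ al, ∑ be, B al be * ((p al : ℝ) : ℂ) * ((q be : ℝ) : ℂ)‖
        ≤ 192 * Mb * (‖p‖ ^ 2 * ‖q‖ + ‖p‖ * ‖q‖ ^ 2) := by
    intro p q
    refine le_of_forall_pos_le_add fun δ hδ => ?_
    set D : ℝ := 4 + 16 * (‖p‖ * ‖q‖) with hD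
    have hD0 : 0 < D := by positivity
    have hδ' : 0 < δ / D := div_pos hδ hD0
    have e6 : ∀ᶠ j in atTop, ‖Bk (φs j) - B‖ ≤ δ / D :=
      (tendsto_iff_norm_sub_tendsto_zero.mp hlim).eventually (eventually_le_nhds hδ')
    obtain ⟨j, hj1, hj2, hj3, hj4, hj5, hj6⟩ := ((hφt.eventually (hconv p q _ hδ')).and
      ((hφt.eventually (hconv p 0 _ hδ')).and ((hφt.eventually (hconv 0 q _ hδ')).and
      ((hφt.eventually (hconv 0 0 _ hδ')).and ((hφt.eventually hR).and e6))))).exists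
    have i1 : ‖Φ (φs j) p q - Γ p q‖ ≤ δ / D := hj1 (L (φs j)) le_rfl
    have i2 : ‖Φ (φs j) p 0 - Γ p 0‖ ≤ δ / D := hj2 (L (φs j)) le_rfl
    have i3 : ‖Φ (φs j) 0 q - Γ 0 q‖ ≤ δ / D := hj3 (L (φs j)) le_rfl
    have i4 : ‖Φ (φs j) 0 0 - Γ 0 0‖ ≤ δ / D := hj4 (L (φs j)) le_rfl
    have i5 := hj5 p q
    have i6 : ‖∑ al, ∑ be, Bk (φs j) al be * ((p al : ℝ) : ℂ) * ((q be : ℝ) : ℂ) -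
        ∑ al, ∑ be, B al be * ((p al : ℝ) : ℂ) * ((q be : ℝ) : ℂ)‖ ≤
          16 * (‖p‖ * ‖q‖) * (δ / D) := by
      calc ‖∑ al, ∑ be, Bk (φs j) al be * ((p al : ℝ) : ℂ) * ((q be : ℝ) : ℂ) -
            ∑ al, ∑ be, B al be * ((p al : ℝ) : ℂ) * ((q be : ℝ) : ℂ)‖
          = ‖∑ al, ∑ be, (Bk (φs j) - B) al be * ((p al : ℝ) : ℂ) * ((q be : ℝ) : ℂ)‖ := by
            congr 1
            simp only [← Finset.sum_sub_distrib, Pi.sub_apply, sub_mul]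
        _ ≤ ∑ al, ∑ be, ‖(Bk (φs j) - B) al be * ((p al : ℝ) : ℂ) * ((q be : ℝ) : ℂ)‖ :=
            (norm_sum_le _ _).trans (Finset.sum_le_sum fun al _ => norm_sum_le _ _)
        _ ≤ ∑ _al : Fin 4, ∑ _be : Fin 4, ‖Bk (φs j) - B‖ * ‖p‖ * ‖q‖ := by
            refine Finset.sum_le_sum fun al _ => Finset.sum_le_sum fun be _ => ?_
            rw [norm_mul, norm_mul, Complex.norm_real, Complex.norm_real]
            have h1 : ‖(Bk (φs j) - B) al be‖ ≤ ‖Bk (φs j) - B‖ :=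
              (norm_le_pi_norm _ be).trans (norm_le_pi_norm _ al)
            have h2 : ‖p al‖ ≤ ‖p‖ := norm_le_pi_norm p al
            have h3 : ‖q be‖ ≤ ‖q‖ := norm_le_pi_norm q be
            gcongr
        _ = 16 * (‖p‖ * ‖q‖) * ‖Bk (φs j) - B‖ := by
            simp only [Finset.sum_const, Finset.card_univ, Fintype.card_fin, nsmul_eq_mul]
            push_cast; ring
        _ ≤ 16 * (‖p‖ * ‖q‖) * (δ / D) := by gcongr
    have key : Γ p q - Γ p 0 - Γ 0 q + Γ 0 0 -
          ∑ al, ∑ be, B al be * ((p al : ℝ) : ℂ) * ((q be : ℝ) : ℂ)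
        = -(Φ (φs j) p q - Γ p q) + (Φ (φs j) p 0 - Γ p 0) + (Φ (φs j) 0 q - Γ 0 q)
          - (Φ (φs j) 0 0 - Γ 0 0)
          + (Φ (φs j) p q - Φ (φs j) p 0 - Φ (φs j) 0 q + Φ (φs j) 0 0 -
              ∑ al, ∑ be, Bk (φs j) al be * ((p al : ℝ) : ℂ) * ((q be : ℝ) : ℂ))
          + (∑ al, ∑ be, Bk (φs j) al be * ((p al : ℝ) : ℂ) * ((q be : ℝ) : ℂ) -
              ∑ al, ∑ be, B al be * ((p al : ℝ) : ℂ) * ((q be : ℝ) : ℂ)) := by ring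
    rw [key]
    have n1 := norm_add_le (-(Φ (φs j) p q - Γ p q) + (Φ (φs j) p 0 - Γ p 0) +
          (Φ (φs j) 0 q - Γ 0 q) - (Φ (φs j) 0 0 - Γ 0 0)
          + (Φ (φs j) p q - Φ (φs j) p 0 - Φ (φs j) 0 q + Φ (φs j) 0 0 -
              ∑ al, ∑ be, Bk (φs j) al be * ((p al : ℝ) : ℂ) * ((q be : ℝ) : ℂ)))
      (∑ al, ∑ be, Bk (φs j) al be * ((p al : ℝ) : ℂ) * ((q be : ℝ) : ℂ) -
              ∑ al, ∑ be, B al be * ((p al : ℝ) : ℂ) * ((q be : ℝ) : ℂ))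
    have n2 := norm_add_le (-(Φ (φs j) p q - Γ p q) + (Φ (φs j) p 0 - Γ p 0) +
          (Φ (φs j) 0 q - Γ 0 q) - (Φ (φs j) 0 0 - Γ 0 0))
      (Φ (φs j) p q - Φ (φs j) p 0 - Φ (φs j) 0 q + Φ (φs j) 0 0 -
              ∑ al, ∑ be, Bk (φs j) al be * ((p al : ℝ) : ℂ) * ((q be : ℝ) : ℂ))
    have n3 := norm_sub_le (-(Φ (φs j) p q - Γ p q) + (Φ (φs j) p 0 - Γ p 0) +
        (Φ (φs j) 0 q - Γ 0 q)) (Φ (φs j) 0 0 - Γ 0 0)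
    have n4 := norm_add_le (-(Φ (φs j) p q - Γ p q) + (Φ (φs j) p 0 - Γ p 0)) (Φ (φs j) 0 q - Γ 0 q)
    have n5 := norm_add_le (-(Φ (φs j) p q - Γ p q)) (Φ (φs j) p 0 - Γ p 0)
    rw [norm_neg] at n5
    have hDδ : (4 + 16 * (‖p‖ * ‖q‖)) * (δ / D) = δ := by
      rw [hD]; field_simp
    linarith
  -- Step 5: the cubic bound gives `o(‖(p,q)‖²)`
  rw [Asymptotics.isLittleO_iff]
  intro c hc
  rw [Metric.eventually_nhds_iff]
  refine ⟨c / (384 * Mb + 1), by positivity, fun k hk => ?_⟩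
  rw [dist_zero_right] at hk
  have hp : ‖k.1‖ ≤ ‖k‖ := norm_fst_le k
  have hq : ‖k.2‖ ≤ ‖k‖ := norm_snd_le k
  have hn2 : ‖(‖k‖ ^ 2 : ℝ)‖ = ‖k‖ ^ 2 := by rw [norm_pow, norm_norm]
  rw [hn2]
  refine (hpt k.1 k.2).trans ?_
  calc 192 * Mb * (‖k.1‖ ^ 2 * ‖k.2‖ + ‖k.1‖ * ‖k.2‖ ^ 2)
      ≤ 192 * Mb * (‖k‖ ^ 2 * ‖k‖ + ‖k‖ * ‖k‖ ^ 2) := by gcongr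
    _ = (384 * Mb * ‖k‖) * ‖k‖ ^ 2 := by ring
    _ ≤ (384 * Mb * (c / (384 * Mb + 1))) * ‖k‖ ^ 2 := by gcongr
    _ ≤ c * ‖k‖ ^ 2 := by
        gcongr
        rw [mul_div_assoc', div_le_iff₀ (by positivity)]
        nlinarith

end Summit.QuantumFields.QCD.Cruxes.RobustYangMillsHandover.LeeYangMassHandover
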